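import Summits.BirchSwinnertonDyer.BirchSwinnertonDyer.Theorems.ManinLocalTwoThreeGammaOneWitness
import Summits.BirchSwinnertonDyer.Rank1Residual.ManinAdditive.GammaOneKatoRoad

/-!
# E-es-111♯ `GammaOneTowerUnitTwist p` AND E-es-111 `TwoAdicGammaOneWitnessLaw` HOLD, BY NAME (cell bsd-f2-manin, es lens MEMO-es §38;
# typer leaf `…/ManinAdditive/GammaOneKatoRoad.lean` p688131; seat `bsd-line-manin23-p2` gen 12)

Summit `BirchSwinnertonDyer`, route `ManinLocalTwoThree`, crux C2 `ManinOddAtFour` (stmt-BirchSwinnertonDyer-22967), skeleton v14 stub 6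
`GammaOneOddOnBlindClasses`.  The es lens' Γ₁ Kato road reads stub 6 ⟸ {E-es-110 `KatoNeronIntegralTwoGamma1Optimal`, E-es-111
`TwoAdicGammaOneWitnessLaw`} (Sketch-es-g24 §3, p1's `…GammaOneKatoRoad` theorems).  THIS FILE discharges the second input and its tower
form BY NAME from the by-value theorems of `…GammaOneTowerUnitTwist` / `…GammaOneWitness`:

* **`gammaOneTowerUnitTwist_holds : p.Prime → KatoCurve.GammaOneTowerUnitTwist p`** (E-es-111♯, every prime `p`; the Γ₁-normalised
  tower unit-twist law WITHOUT the plus-index hypothesis — `exists_primitive_even_gammaOneUnitTwistAt`);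
* **`twoAdicGammaOneWitness_holds : IsNewformOf V f → KatoCurve.TwoAdicGammaOneWitness V f`** (every newform pair) and
  **`twoAdicGammaOneWitnessLaw_holds : KatoCurve.TwoAdicGammaOneWitnessLaw`** (E-es-111; its optimality / additivity binders are idle —
  `exists_twoAdicGammaOneWitness`).

CONSEQUENCE (for the LEAD's census; composed in p1's `…GammaOneKatoRoad` theorems file): v14 stub 6 `GammaOneOddOnBlindClasses` ⟸
`exists_isNewformOf ∧ KatoNeronIntegralTwoGamma1Optimal` — the Néron half E-es-110 ALONE (not in print at `E₁`, es §38.4).  HONEST FRAMING: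
C2 `ManinOddAtFour`, Manin's conjecture and BSD are NOT proved by this file.  No definitions, no named facts, no sorry.
-/

set_option linter.dupNamespace false
set_option autoImplicit false

noncomputable section

open scoped Classical MatrixGroups ModularForm ComplexConjugate

open CongruenceSubgroup Complex Literature.NumberTheory.EllipticCurves
  Literature.NumberTheory.EllipticCurves.ModularForms
  Summit.BirchSwinnertonDyer.Rank1Residual.ManinAdditive.KatoCurve

namespace Summit.BirchSwinnertonDyer.BirchSwinnertonDyer.Theorems.ManinLocalTwoThree

/-- **E-es-111♯ `GammaOneTowerUnitTwist p` HOLDS for every prime `p`, BY NAME** (the Γ₁-normalised tower unit-twist law, no plus-index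
hypothesis): `exists_primitive_even_gammaOneUnitTwistAt`, whose conclusion is `GammaOneUnitTwistAt p W f χ` unfolded. -/
theorem gammaOneTowerUnitTwist_holds {p : ℕ} (hp : p.Prime) : GammaOneTowerUnitTwist p := by
  intro W _ N _ f hWf q _ hq2 hqp hqN hpdiv n₁
  obtain ⟨n, hn, χ, hprim, hev, r, y, hy, hyre, hygen, hr, hunit⟩ :=
    exists_primitive_even_gammaOneUnitTwistAt hp W f hWf q hq2 hqp hqN hpdiv n₁
  exact ⟨n, hn, χ, hprim, hev, r, y, hy, hyre, hygen, hr, hunit⟩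

/-- `GammaOneTowerUnitTwist 2` and `GammaOneTowerUnitTwist 3` (the instances feeding C2 / C3). -/
theorem gammaOneTowerUnitTwist_two : GammaOneTowerUnitTwist 2 := gammaOneTowerUnitTwist_holds Nat.prime_two

/-- See `gammaOneTowerUnitTwist_two`. -/
theorem gammaOneTowerUnitTwist_three : GammaOneTowerUnitTwist 3 := gammaOneTowerUnitTwist_holds Nat.prime_three

/-- **Every rational newform pair `(V, f)` has a 2-adic Γ₁-witness `KatoCurve.TwoAdicGammaOneWitness V f`, BY NAME**
(`exists_twoAdicGammaOneWitness`). -/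
theorem twoAdicGammaOneWitness_holds (V : WeierstrassCurve ℚ) [V.IsElliptic] {N : ℕ} [NeZero N]
    (f : CuspForm (Gamma0 N) 2) (hVf : IsNewformOf V f) : TwoAdicGammaOneWitness V f := by
  obtain ⟨m, hm, χ, hcop, hprim, hne, hord, h8, r, y, hy, hyre, hygen, hr, hunit⟩ :=
    exists_twoAdicGammaOneWitness V f hVf
  exact ⟨m, hm, χ, hcop, hprim, hne, hord, h8, r, y, hy, hyre, hygen, hr, hunit⟩

/-- **E-es-111 `TwoAdicGammaOneWitnessLaw` HOLDS, BY NAME** (LAW-V₁ at `p = 2`, witness form; its binders `IsOptimal`, «additive at 2»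
are idle: every newform pair has the witness). -/
theorem twoAdicGammaOneWitnessLaw_holds : TwoAdicGammaOneWitnessLaw := by
  intro V _ _ N _ D₁ _ _ _
  exact twoAdicGammaOneWitness_holds V D₁.f D₁.isNewformOf

end Summit.BirchSwinnertonDyer.BirchSwinnertonDyer.Theorems.ManinLocalTwoThree

end
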